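import Summits.ValiantsHypothesis.ValiantsHypothesis.Theses.BarrierLever
import Summits.ValiantsHypothesis.ValiantsHypothesis.Theorems.BarrierLeverPriorityPeelingMoves

/-!
# Route BarrierLever — item 19759 `PairMoveSound` (the MARKED pair move of the PP calculus, by name)

Item `stmt-ValiantsHypothesis-19759` (support, rank 9; planner p1-g11; cell valiant-natproofs, rung V4,
𝒟-side door (c)): the PAIR MOVE of prover gen 7's priority-peeling calculus in MAP encoding and BLOCK
form, in the planner's MARKED generality — one priority function `prio` with a strict maximum at slot `0`
of every column, and an ARBITRARY set `T` of column literals deciding the group of a column by its top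
literal only (gen 7's kernel `PriorityPeeling.pairMove` / `pairMove'` is the prefix form, where group-1
columns avoid the marked set altogether). Rows: `r = k + m`, slot `0` carries `ℓ₀` on the first `k` rows
and `ℓ₁` on the last `m`, the other slots avoid both; columns: the first `k` have their top literal in
`T`, the last `m` outside `T`. CLAIM: ALIVE(child₀) ∧ ALIVE(child₁) ⇒ ALIVE(parent), children = drop
slot `0` inside each diagonal block.

**Proof** (planner p1-g11's ONE-SCALE argument, PP-programme-g11 §1). Take one `G'` good for both
children (`PriorityPeeling.exists_common_of_alive`). Over `ℂ[X]` put row `ℓ₀ := (X^{2·prio y + [y ∈ T]})_y`,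
row `ℓ₁ := (X^{2·prio y + [y ∉ T]})_y` (FULL support), every other row the constant row of `G'`. A minor
`det G[ρ i, κ j]` is, by Laplace along slot `0` (`Matrix.det_succ_row_zero`, sign `+1`), a polynomial of
degree `≤ b j := 2·prio(κ j 0) + 1`, and its `X^{b j}`-coefficient is the child minor
`det G'[ρ i ∘ succ, κ j ∘ succ]` when the row block of `i` matches the column block of `j` and `0`
otherwise (the parity bit). By the column-degree lemma (`PriorityPeeling.coeff_det_of_natDegree_le_col`)
the `X^{Σ b j}`-coefficient of the layout determinant is the determinant of the child-minor matrix masked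
to the two diagonal blocks, i.e. `det child₀ · det child₁ ≠ 0` (`Matrix.det_fromBlocks_zero₂₁` after
`finSumFinEquiv`); evaluate at a non-root.

WHAT THIS IS NOT: one elementary reduction step; with items 19760 (shear) and 19766 (glue, closed) it
reduces TT (item 19152) to the combinatorial conjecture 19761 (PP certificates exist). Nothing on crux
stmt-ValiantsHypothesis-14610 or on VP vs VNP.
-/

-- layout Summits/ValiantsHypothesis/ValiantsHypothesis forces the duplicated namespace component
set_option linter.dupNamespace false

namespace Summit.ValiantsHypothesis.ValiantsHypothesis.Theorems.BarrierLever.MarkedPairMove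

open Polynomial Matrix

/-! ## 1. Laplace along a full monomial row at slot 0 -/

section Row

variable {d : ℕ}

/-- Laplace expansion along row `0` of a matrix whose row `0` is `q ↦ X^{e q}` and whose other rows
are constants (adapted from `PriorityPeeling.det_sparseRowMatrix`, full support, position `0`). -/
theorem det_monomialRow (B : Matrix (Fin (d + 1)) (Fin (d + 1)) ℂ) (e : Fin (d + 1) → ℕ) :
    (Matrix.of fun a q => if a = 0 then X ^ (e q) else C (B a q) :
      Matrix (Fin (d + 1)) (Fin (d + 1)) ℂ[X]).det = ∑ q : Fin (d + 1),
      C ((-1 : ℂ) ^ (q : ℕ) * (B.submatrix Fin.succ q.succAbove).det) * X ^ (e q) := by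
  rw [Matrix.det_succ_row_zero]
  refine Finset.sum_congr rfl fun q _ => ?_
  have hsub : (Matrix.of fun a q' => if a = 0 then X ^ (e q') else C (B a q') :
      Matrix (Fin (d + 1)) (Fin (d + 1)) ℂ[X]).submatrix Fin.succ q.succAbove =
      (B.submatrix Fin.succ q.succAbove).map C := by
    ext a b
    simp only [Matrix.submatrix_apply, Matrix.map_apply, Matrix.of_apply,
      if_neg (Fin.succ_ne_zero a)]
  have hrow : (Matrix.of fun a q' => if a = 0 then X ^ (e q') else C (B a q') :
      Matrix (Fin (d + 1)) (Fin (d + 1)) ℂ[X]) 0 q = X ^ (e q) := by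
    simp only [Matrix.of_apply, if_true]
  rw [hsub, hrow]
  have hdet : ((B.submatrix Fin.succ q.succAbove).map C).det =
      C ((B.submatrix Fin.succ q.succAbove).det) :=
    (RingHom.map_det (C : ℂ →+* ℂ[X]) _).symm
  rw [hdet, map_mul, map_pow, map_neg, map_one]
  ring

/-- Degree bound: if every exponent is `≤ E`, the determinant has degree `≤ E`. -/
theorem natDegree_det_monomialRow_le (B : Matrix (Fin (d + 1)) (Fin (d + 1)) ℂ)
    (e : Fin (d + 1) → ℕ) (E : ℕ) (hE : ∀ q, e q ≤ E) :
    ((Matrix.of fun a q => if a = 0 then X ^ (e q) else C (B a q) :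
      Matrix (Fin (d + 1)) (Fin (d + 1)) ℂ[X]).det).natDegree ≤ E := by
  rw [det_monomialRow]
  refine natDegree_sum_le_of_forall_le _ _ (fun q _ => ?_)
  exact (natDegree_C_mul_X_pow_le _ _).trans (hE q)

/-- Top coefficient: if slot `0` carries the STRICTLY largest exponent, the coefficient of `X^{e 0}`
is the minor complementary to `(0, 0)`. -/
theorem coeff_det_monomialRow_top (B : Matrix (Fin (d + 1)) (Fin (d + 1)) ℂ)
    (e : Fin (d + 1) → ℕ) (htop : ∀ q, q ≠ 0 → e q < e 0) :
    ((Matrix.of fun a q => if a = 0 then X ^ (e q) else C (B a q) :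
      Matrix (Fin (d + 1)) (Fin (d + 1)) ℂ[X]).det).coeff (e 0) =
      (B.submatrix Fin.succ Fin.succ).det := by
  rw [det_monomialRow, finsetSum_coeff, Finset.sum_eq_single (0 : Fin (d + 1))]
  · rw [coeff_C_mul_X_pow, if_pos rfl, Fin.val_zero, pow_zero, one_mul, Fin.succAbove_zero]
  · intro q _ hq
    rw [coeff_C_mul_X_pow, if_neg (Nat.ne_of_gt (htop q hq))]
  · intro h
    exact absurd (Finset.mem_univ _) h

/-- Vanishing coefficient: if every exponent is `< E`, the coefficient of `X^E` is `0`. -/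
theorem coeff_det_monomialRow_eq_zero (B : Matrix (Fin (d + 1)) (Fin (d + 1)) ℂ)
    (e : Fin (d + 1) → ℕ) (E : ℕ) (hE : ∀ q, e q < E) :
    ((Matrix.of fun a q => if a = 0 then X ^ (e q) else C (B a q) :
      Matrix (Fin (d + 1)) (Fin (d + 1)) ℂ[X]).det).coeff E = 0 := by
  rw [det_monomialRow, finsetSum_coeff]
  refine Finset.sum_eq_zero (fun q _ => ?_)
  rw [coeff_C_mul_X_pow, if_neg (Nat.ne_of_gt (hE q))]

end Row

/-! ## 2. The marked pair move -/

/-- **Item 19759 `PairMoveSound`** (the route decl, by name). -/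
theorem pairMoveSound : Theses.BarrierLever.PairMoveSound := by
  classical
  intro nr nc k m d ρ κ ℓ₀ ℓ₁ prio T hℓ hρ₀ hρ₁ hρ hprio hT₀ hT₁ h₀ h₁
  -- one matrix good for both children
  obtain ⟨G', hG'₀, hG'₁⟩ := PriorityPeeling.exists_common_of_alive
    (fun (i : Fin k) (a : Fin d) => ρ (Fin.castAdd m i) a.succ)
    (fun (j : Fin k) (c : Fin d) => κ (Fin.castAdd m j) c.succ)
    (fun (i : Fin m) (a : Fin d) => ρ (Fin.natAdd k i) a.succ)
    (fun (j : Fin m) (c : Fin d) => κ (Fin.natAdd k j) c.succ) h₀ h₁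
  -- the two weights and the specialised matrix over ℂ[X]
  set w₀ : Fin nc → ℕ := fun y => 2 * prio y + (if y ∈ T then 1 else 0) with hw₀
  set w₁ : Fin nc → ℕ := fun y => 2 * prio y + (if y ∈ T then 0 else 1) with hw₁
  set Gs : Matrix (Fin nr) (Fin nc) ℂ[X] := Matrix.of fun x y =>
    if x = ℓ₀ then X ^ (w₀ y) else if x = ℓ₁ then X ^ (w₁ y) else C (G' x y) with hGs
  -- the layout matrix over ℂ[X] and the column degree bounds
  set N : Matrix (Fin (k + m)) (Fin (k + m)) ℂ[X] :=
    Matrix.of fun i j => (Gs.submatrix (ρ i) (κ j)).det with hN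
  set b : Fin (k + m) → ℕ := fun j => 2 * prio (κ j 0) + 1 with hb
  -- child minors of `G'`
  set X' : Matrix (Fin (k + m)) (Fin (k + m)) ℂ := Matrix.of fun i j =>
    (G'.submatrix (fun a : Fin d => ρ i a.succ) (fun c : Fin d => κ j c.succ)).det with hX'
  -- the minors as monomial-row matrices
  have hrow₀ : ∀ (i : Fin k) (j : Fin (k + m)), Gs.submatrix (ρ (Fin.castAdd m i)) (κ j) =
      (Matrix.of fun a q => if a = 0 then X ^ (w₀ (κ j q)) else
        C ((G'.submatrix (ρ (Fin.castAdd m i)) (κ j)) a q) :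
        Matrix (Fin (d + 1)) (Fin (d + 1)) ℂ[X]) := by
    intro i j
    ext a q
    simp only [hGs, Matrix.submatrix_apply, Matrix.of_apply]
    refine Fin.cases ?_ (fun a' => ?_) a
    · rw [hρ₀ i, if_pos rfl, if_pos rfl]
    · rw [if_neg (hρ _ a').1, if_neg (hρ _ a').2, if_neg (Fin.succ_ne_zero a')]
  have hrow₁ : ∀ (i : Fin m) (j : Fin (k + m)), Gs.submatrix (ρ (Fin.natAdd k i)) (κ j) =
      (Matrix.of fun a q => if a = 0 then X ^ (w₁ (κ j q)) else
        C ((G'.submatrix (ρ (Fin.natAdd k i)) (κ j)) a q) :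
        Matrix (Fin (d + 1)) (Fin (d + 1)) ℂ[X]) := by
    intro i j
    ext a q
    simp only [hGs, Matrix.submatrix_apply, Matrix.of_apply]
    refine Fin.cases ?_ (fun a' => ?_) a
    · rw [hρ₁ i, if_neg hℓ.symm, if_pos rfl, if_pos rfl]
    · rw [if_neg (hρ _ a').1, if_neg (hρ _ a').2, if_neg (Fin.succ_ne_zero a')]
  -- exponent bounds inside a column
  have hw₀_le : ∀ (j : Fin (k + m)) (q : Fin (d + 1)), w₀ (κ j q) ≤ b j := by
    intro j q
    simp only [hw₀, hb]
    refine Fin.cases ?_ (fun c => ?_) q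
    · split_ifs <;> omega
    · have := hprio j c
      split_ifs <;> omega
  have hw₁_le : ∀ (j : Fin (k + m)) (q : Fin (d + 1)), w₁ (κ j q) ≤ b j := by
    intro j q
    simp only [hw₁, hb]
    refine Fin.cases ?_ (fun c => ?_) q
    · split_ifs <;> omega
    · have := hprio j c
      split_ifs <;> omega
  have hw₀_lt : ∀ (j : Fin (k + m)) (q : Fin (d + 1)), q ≠ 0 → w₀ (κ j q) < b j := by
    intro j q hq
    obtain ⟨c, rfl⟩ := Fin.exists_succ_eq.mpr hq
    have := hprio j c
    simp only [hw₀, hb]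
    split_ifs <;> omega
  have hw₁_lt : ∀ (j : Fin (k + m)) (q : Fin (d + 1)), q ≠ 0 → w₁ (κ j q) < b j := by
    intro j q hq
    obtain ⟨c, rfl⟩ := Fin.exists_succ_eq.mpr hq
    have := hprio j c
    simp only [hw₁, hb]
    split_ifs <;> omega
  -- column degree bound for every entry
  have hdeg : ∀ i j, (N i j).natDegree ≤ b j := by
    intro i j
    rw [hN, Matrix.of_apply]
    refine Fin.addCases (fun i' => ?_) (fun i' => ?_) i
    · rw [hrow₀ i' j]
      exact natDegree_det_monomialRow_le _ _ _ (hw₀_le j)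
    · rw [hrow₁ i' j]
      exact natDegree_det_monomialRow_le _ _ _ (hw₁_le j)
  -- the four blocks of the top-coefficient matrix
  have hsucc : ∀ (i j : Fin (k + m)), ((G'.submatrix (ρ i) (κ j)).submatrix Fin.succ Fin.succ).det
      = X' i j := by
    intro i j
    rw [hX', Matrix.of_apply]
    rfl
  have hc₀₀ : ∀ (i j : Fin k), (N (Fin.castAdd m i) (Fin.castAdd m j)).coeff (b (Fin.castAdd m j))
      = X' (Fin.castAdd m i) (Fin.castAdd m j) := by
    intro i j
    have htop : w₀ (κ (Fin.castAdd m j) 0) = b (Fin.castAdd m j) := by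
      simp only [hw₀, hb, if_pos (hT₀ j)]
    rw [hN, Matrix.of_apply, hrow₀, ← htop, coeff_det_monomialRow_top _ _ (fun q hq => ?_), hsucc]
    rw [htop]
    exact hw₀_lt _ q hq
  have hc₁₁ : ∀ (i j : Fin m), (N (Fin.natAdd k i) (Fin.natAdd k j)).coeff (b (Fin.natAdd k j))
      = X' (Fin.natAdd k i) (Fin.natAdd k j) := by
    intro i j
    have htop : w₁ (κ (Fin.natAdd k j) 0) = b (Fin.natAdd k j) := by
      simp only [hw₁, hb, if_neg (hT₁ j)]
    rw [hN, Matrix.of_apply, hrow₁, ← htop, coeff_det_monomialRow_top _ _ (fun q hq => ?_), hsucc]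
    rw [htop]
    exact hw₁_lt _ q hq
  have hc₀₁ : ∀ (i : Fin k) (j : Fin m),
      (N (Fin.castAdd m i) (Fin.natAdd k j)).coeff (b (Fin.natAdd k j)) = 0 := by
    intro i j
    rw [hN, Matrix.of_apply, hrow₀]
    refine coeff_det_monomialRow_eq_zero _ _ _ (fun q => ?_)
    refine Fin.cases ?_ (fun c => hw₀_lt _ _ (Fin.succ_ne_zero c)) q
    simp only [hw₀, hb, if_neg (hT₁ j)]
    omega
  have hc₁₀ : ∀ (i : Fin m) (j : Fin k),
      (N (Fin.natAdd k i) (Fin.castAdd m j)).coeff (b (Fin.castAdd m j)) = 0 := by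
    intro i j
    rw [hN, Matrix.of_apply, hrow₁]
    refine coeff_det_monomialRow_eq_zero _ _ _ (fun q => ?_)
    refine Fin.cases ?_ (fun c => hw₁_lt _ _ (Fin.succ_ne_zero c)) q
    simp only [hw₁, hb, if_pos (hT₀ j)]
    omega
  -- the top-coefficient matrix is block diagonal with the two child layout matrices as blocks
  have hblocks : (Matrix.of fun i j : Fin (k + m) => (N i j).coeff (b j)).submatrix
      finSumFinEquiv finSumFinEquiv =
      Matrix.fromBlocks
        (Matrix.of fun i j : Fin k => X' (Fin.castAdd m i) (Fin.castAdd m j)) 0 0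
        (Matrix.of fun i j : Fin m => X' (Fin.natAdd k i) (Fin.natAdd k j)) := by
    ext (i | i) (j | j)
    · simp only [Matrix.submatrix_apply, finSumFinEquiv_apply_left, Matrix.of_apply,
        Matrix.fromBlocks_apply₁₁, hc₀₀]
    · simp only [Matrix.submatrix_apply, finSumFinEquiv_apply_left, finSumFinEquiv_apply_right,
        Matrix.of_apply, Matrix.fromBlocks_apply₁₂, Matrix.zero_apply, hc₀₁]
    · simp only [Matrix.submatrix_apply, finSumFinEquiv_apply_left, finSumFinEquiv_apply_right,
        Matrix.of_apply, Matrix.fromBlocks_apply₂₁, Matrix.zero_apply, hc₁₀]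
    · simp only [Matrix.submatrix_apply, finSumFinEquiv_apply_right, Matrix.of_apply,
        Matrix.fromBlocks_apply₂₂, hc₁₁]
  have hA : (Matrix.of fun i j : Fin k => X' (Fin.castAdd m i) (Fin.castAdd m j)).det ≠ 0 := by
    have : (Matrix.of fun i j : Fin k => X' (Fin.castAdd m i) (Fin.castAdd m j)) =
        Matrix.of fun i j : Fin k => (G'.submatrix (fun a : Fin d => ρ (Fin.castAdd m i) a.succ)
          (fun c : Fin d => κ (Fin.castAdd m j) c.succ)).det := by
      ext i j
      simp only [hX', Matrix.of_apply]
    rw [this]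
    exact hG'₀
  have hD : (Matrix.of fun i j : Fin m => X' (Fin.natAdd k i) (Fin.natAdd k j)).det ≠ 0 := by
    have : (Matrix.of fun i j : Fin m => X' (Fin.natAdd k i) (Fin.natAdd k j)) =
        Matrix.of fun i j : Fin m => (G'.submatrix (fun a : Fin d => ρ (Fin.natAdd k i) a.succ)
          (fun c : Fin d => κ (Fin.natAdd k j) c.succ)).det := by
      ext i j
      simp only [hX', Matrix.of_apply]
    rw [this]
    exact hG'₁
  -- hence the layout determinant over ℂ[X] is a nonzero polynomial
  have hN0 : N.det ≠ 0 := by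
    intro h0
    have hc := PriorityPeeling.coeff_det_of_natDegree_le_col N b hdeg
    rw [h0, coeff_zero] at hc
    have hdet : (Matrix.of fun i j : Fin (k + m) => (N i j).coeff (b j)).det =
        (Matrix.of fun i j : Fin k => X' (Fin.castAdd m i) (Fin.castAdd m j)).det *
        (Matrix.of fun i j : Fin m => X' (Fin.natAdd k i) (Fin.natAdd k j)).det := by
      rw [← Matrix.det_submatrix_equiv_self finSumFinEquiv, hblocks, Matrix.det_fromBlocks_zero₂₁]
    rw [hdet] at hc
    exact mul_ne_zero hA hD hc.symm
  -- evaluate at a non-root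
  obtain ⟨t, ht⟩ := PriorityPeeling.exists_eval_ne_zero_of_ne_zero _ hN0
  refine ⟨Gs.map (Polynomial.eval t), ?_⟩
  have hev := PriorityPeeling.map_layoutDet (Polynomial.evalRingHom t) ρ κ Gs
  rw [Polynomial.coe_evalRingHom] at hev
  rw [← hev]
  exact ht

end Summit.ValiantsHypothesis.ValiantsHypothesis.Theorems.BarrierLever.MarkedPairMove
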